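import Summits.QuantumFields.YangMills.Theorems.BalabanLadderIRAbstractBasinRung24
import HarnessLib

/-!
# Purity climbs in `L` at fixed `β`: ONE `1/24`-pure cold box ⇒ a `2⁻²⁵`-pure cold box of side `2¹⁴·L`, same `β` (content-free helper)

Ideator ym-ir-idea-11 g0, line `thermal-ratchet` (§2h, rev 12) on crux `BalabanLadder.IR` (stmt-QuantumFields-19354, rung R2c); crit-3's
P3 «re-base the certificate on idea-9's widened basin».  A pure COMPOSITION, by name, of the landed basin rungs
`BasinRung.basin_step24` (idea-9, Rung24), `basin_step6` (Rung6), `basin_step8` (Rung8), `basin_step9` (Rung; `defectSquaring_double_sharp`)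
applied to the Wilson family (`axisSymmetric`, `tracePositive`, `volumeBounds`): at FIXED `β ≥ 0`, `δᶜ_β(L) ≤ 1/24` with `L ≥ 8` forces
`δᶜ_β(2¹⁴·L) ≤ 2⁻²⁵` — fourteen exact doublings with the scale factor EXPLICIT (the `AbstractBasin` Props hide it behind `∃ L'`), which is
what a certificate of BOUNDED PHYSICAL SIZE needs (`T ↦ 2¹⁴·T`).  Use (line `thermal-ratchet`): the cofinal decidable instances of the bill
`IR ⇐ M♭₂ ∧ CERT ∧ N` may certify the cold purity defect at the few-percent level `1/24` instead of `2⁻²⁵`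
(`ThermalRatchet.IR_of_slackRatchet24` in the crux workfile).

HONEST FRAMING.  Content-free real arithmetic over landed theorems; nothing here proves the Yang–Mills mass gap (Clay), the crux `IR`,
`E`, any heredity sign or a lattice gap; R4 (`BalabanUVStability4`) closes only the conditional finite-`𝕋⁴` rung `BalabanLadder.UV`.
-/

open MeasureTheory Filter Topology
open Literature.MathematicalPhysics.QuantumFieldTheory Literature.MathematicalPhysics.QuantumLattice
open Summit.QuantumFields.YangMills.Cruxes.IR.ColdPurityBridge (coldDefect)
open Summit.QuantumFields.YangMills.Cruxes.IR.AspectBootstrap (boxDefect coldDefect_eq_boxDefect axisSymmetric tracePositive volumeBounds)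
open Summit.QuantumFields.YangMills.Cruxes.IR.BasinRung (basin_step24 basin_step6 basin_step8 basin_step9)

namespace Summit.QuantumFields.YangMills.Cruxes.IR.PurityClimb

variable {G : Type} [Group G] [TopologicalSpace G] [IsTopologicalGroup G] [CompactSpace G] [MeasurableSpace G] [BorelSpace G]

/-- **Purity climbs in `L` at fixed `β ≥ 0`**: `δᶜ_β(L) ≤ 1/24`, `L ≥ 8` ⇒ `δᶜ_β(2¹⁴·L) ≤ 2⁻²⁵` (rungs `1/24 → 2⁻⁶ → 2⁻⁸ → 2⁻⁹ → … `,
fourteen exact doublings: `×4, ×4` by `basin_step24`, `×2, ×2` by `basin_step6`, `×2, ×2` by `basin_step8`, `×2⁶` by `basin_step9`). -/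
theorem coldDefect_widen_24 (r : LatticeRep G) {β : ℝ} (hβ : 0 ≤ β) (L : ℕ) (hL : 8 ≤ L)
    (h : coldDefect r.ρ β L ≤ 1 / 24) : coldDefect r.ρ β (16384 * L) ≤ 1 / 2 ^ 25 := by
  have hS := axisSymmetric r β
  have hT := tracePositive r hβ
  have hV := volumeBounds r hβ
  rw [coldDefect_eq_boxDefect] at h ⊢
  have h1 := basin_step24 hS hT L hL h le_rfl
  have h1' : boxDefect (wilsonFinTorusPartition r.ρ β) (4 * L) ≤ 0.032 := h1.trans (by norm_num)
  have h2 := basin_step24 hS hT (4 * L) (by omega) h1' (by norm_num)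
  have h2' : boxDefect (wilsonFinTorusPartition r.ρ β) (4 * (4 * L)) ≤ 1 / 2 ^ 6 := h2.trans (by norm_num)
  have h3 := basin_step6 hS hT (4 * (4 * L)) (by omega) h2' le_rfl
  have h4 := basin_step6 hS hT (2 * (4 * (4 * L))) (by omega) h3 (by norm_num)
  have h4' : boxDefect (wilsonFinTorusPartition r.ρ β) (2 * (2 * (4 * (4 * L)))) ≤ 1 / 2 ^ 8 := h4.trans (by norm_num)
  have h5 := basin_step8 hS hT (2 * (2 * (4 * (4 * L)))) (by omega) h4' le_rfl
  have h6 := basin_step8 hS hT (2 * (2 * (2 * (4 * (4 * L))))) (by omega) h5 (by norm_num)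
  have h6' : boxDefect (wilsonFinTorusPartition r.ρ β) (2 * (2 * (2 * (2 * (4 * (4 * L)))))) ≤ 1 / 2 ^ 9 :=
    h6.trans (by norm_num)
  have h7 := basin_step9 hS hT hV (2 * (2 * (2 * (2 * (4 * (4 * L)))))) (by omega) h6' le_rfl
  have h8 := basin_step9 hS hT hV _ (by omega) h7 (by norm_num)
  have h9 := basin_step9 hS hT hV _ (by omega) h8 (by norm_num)
  have h10 := basin_step9 hS hT hV _ (by omega) h9 (by norm_num)
  have h11 := basin_step9 hS hT hV _ (by omega) h10 (by norm_num)
  have h12 := basin_step9 hS hT hV _ (by omega) h11 (by norm_num)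
  have hL' : 16384 * L = 2 * (2 * (2 * (2 * (2 * (2 * (2 * (2 * (2 * (2 * (4 * (4 * L))))))))))) := by ring
  rw [hL']
  exact h12.trans (by norm_num)

/-- The same climb with a free target tolerance `θ ≥ 2⁻²⁵` (monotonicity), for citing at the seam depth `2⁻²⁴ = epsStar` or coarser. -/
theorem coldDefect_widen_24_le (r : LatticeRep G) {β : ℝ} (hβ : 0 ≤ β) (L : ℕ) (hL : 8 ≤ L) {θ : ℝ} (hθ : 1 / 2 ^ 25 ≤ θ)
    (h : coldDefect r.ρ β L ≤ 1 / 24) : coldDefect r.ρ β (16384 * L) ≤ θ :=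
  (coldDefect_widen_24 r hβ L hL h).trans hθ

end Summit.QuantumFields.YangMills.Cruxes.IR.PurityClimb
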